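import Literature.NumberTheory.LFunctions.Zhang2022.DetectorMainTermForm

/-!
# Zhang (2022), programme F-S3 (cell landau-siegel, family B-det): sesquilinearity, polarisation and
# Cauchy–Schwarz for the main-term form `𝔅_R` of an arbitrary detector recipe

Y. Zhang, *Discrete mean estimates and the Landau–Siegel zero*, arXiv:2211.02515v1 [Zhang2022LandauSiegel] —
an unrefereed manuscript under adjudication. **WHAT THIS IS NOT: not a claim about Theorems 1–2 of
arXiv:2211.02515, about Landau–Siegel zeros, or about Parity; nothing here asserts any claim of the manuscript.**
«The programme SEARCHES and TYPES; no claim about Landau–Siegel zeros, Theorems 1–2 of arXiv:2211.02515 or a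
repaired Margin232 until a kernel theorem says so.»

Companion (theorems only) of `DetectorMainTermForm` (definition request D-det-1). For EVERY three-channel
detector recipe `R : Det.DetRecipe` (complex channel weights allowed) the formula-I form `M_R = Det.MformDet R` is
sesquilinear on one-sided kinked profiles (`Repair.KinkedProfile`), its polar form `P_R = Det.FormDetPolar R`
satisfies the polarisation identity `𝔅_R(u + tf) = 𝔅_R(u) + 2Re(t̄·P_R(u,f)) + |t|²𝔅_R(f)` (`formDet_add_smul`),
and therefore **positive semidefiniteness of `𝔅_R` on the one-sided class (`Det.FormDetPSD R`) implies exact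
Cauchy–Schwarz `‖P_R(u,f)‖² ≤ 𝔅_R(u)·𝔅_R(f)`** (`norm_sq_formDetPolar_le_of_psd`) and the «no design closes»
shape `¬(𝔅_R(𝔤)·𝔅_R(f) < ‖P_R(𝔤,f)‖²)`, `¬(√(q·c_J) < d)` for thresholds of polar provenance
(`not_trueNeed_of_psd`, `not_closing_of_psd`) — the detector-generic version of
`MainTermFormCauchySchwarz.norm_sq_mainTermFormPolar_le` / `not_closing_of_isH1` (which is the instance
`R = Det.zhangRecipe`, `Det.FormDet_zhang`). Reading for the cell (OBJECTIVE §1.3 (O4), LEVERS §0.6 (B2)): a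
B-det design whose three main-order constants are values of ONE recipe form `𝔅_R` with `FormDetPSD R` is
decided «no» at main order; the only main-term-level door is an INDEFINITE recipe (`Det.FormDetNegWitness R`).
The discrete-form level (weights `≥ 0` on sampled zeros) is decided independently of any main-term calculus by
`Det.discreteForm_mainOrder_norm_sq_le`. Elementary calculus (one interval-integrability lemma per channel) and the
discriminant argument; no new definitions, no new `Prop` facts.
-/

noncomputable section

open Complex Real ComplexConjugate Set intervalIntegral
open _root_.MeasureTheory

namespace Literature.NumberTheory.LFunctions.Zhang2022

namespace Det

open Repair

variable {R : DetRecipe} {u u' f f' g g' h h' : ℝ → ℂ}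

/-! ### Integrability of one channel on kinked profiles -/

/-- The tail `y ↦ ∫_y^1 h` is continuous on `[0,1]` for `h` continuous there. [cite: Zhang2022LandauSiegel, Prop 7.1, Lemma 8.4] -/
theorem continuousOn_tail_unit (hh : ContinuousOn h (Icc 0 1)) :
    ContinuousOn (fun y => ∫ t in y..(1:ℝ), h t) (Icc 0 1) := by
  have hint : IntegrableOn h (uIcc 0 1) volume := by
    rw [uIcc_of_le zero_le_one]; exact hh.integrableOn_Icc
  have := intervalIntegral.continuousOn_primitive_interval_left hint
  rwa [uIcc_of_le zero_le_one] at this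

/-- The first slot `g′ + iπb g` is integrable on `[0,1]` for a kinked profile. [cite: Zhang2022LandauSiegel, Prop 7.1, Lemma 8.2] -/
theorem intervalIntegrable_firstSlot (hg : KinkedProfile g g') (b : ℝ) :
    IntervalIntegrable (fun y => g' y + I * π * (b : ℂ) * g y) volume 0 1 :=
  hg.isH1.intervalIntegrable.add ((hg.cont.intervalIntegrable_of_Icc zero_le_one).const_mul _)

/-- The continuous part `iπs h + π²n∫_y^1 h` of the second slot is continuous on `[0,1]`.
[cite: Zhang2022LandauSiegel, Prop 7.1, Lemma 8.4] -/
theorem continuousOn_secondSlotCont (hh : KinkedProfile h h') (s n : ℝ) :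
    ContinuousOn (fun y => I * π * (s : ℂ) * h y + (π : ℂ) ^ 2 * (n : ℂ) * ∫ t in y..(1:ℝ), h t) (Icc 0 1) :=
  (continuousOn_const.mul hh.cont).add (continuousOn_const.mul (continuousOn_tail_unit hh.cont))

/-- **One channel of formula I is integrable on `[0,1]`** for kinked profiles `g`, `h` (the first slot is
`L¹`, the second is `L²` plus a continuous function). [cite: Zhang2022LandauSiegel, Prop 7.1, Lemmas 8.2/8.4] -/
theorem intervalIntegrable_dipoleIntegrandDet (hg : KinkedProfile g g') (hh : KinkedProfile h h')
    (b s n : ℝ) : IntervalIntegrable (dipoleIntegrandDet b s n g g' h h') volume 0 1 := by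
  -- atoms
  have hgH := hg.isH1
  have hhH := hh.isH1
  have i1 : IntervalIntegrable (fun x => g' x * conj (h' x)) volume 0 1 :=
    IsH1OnUnitInterval.intervalIntegrable_deriv_mul_conj_deriv hgH hhH
  have hch' : IntervalIntegrable (fun x => conj (h' x)) volume 0 1 := by
    rw [intervalIntegrable_iff, uIoc_of_le zero_le_one]
    exact hhH.memLp_conj.integrable one_le_two
  have i2 : IntervalIntegrable (fun x => g x * conj (h' x)) volume 0 1 :=
    hch'.continuousOn_mul (by rw [uIcc_of_le zero_le_one]; exact hg.cont)
  have i3 : IntervalIntegrable (fun y => (g' y + I * π * (b : ℂ) * g y)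
      * conj (I * π * (s : ℂ) * h y + (π : ℂ) ^ 2 * (n : ℂ) * ∫ t in y..(1:ℝ), h t)) volume 0 1 :=
    (intervalIntegrable_firstSlot hg b).mul_continuousOn
      (by rw [uIcc_of_le zero_le_one]; exact continuousOn_conj_comp (continuousOn_secondSlotCont hh s n))
  have e : dipoleIntegrandDet b s n g g' h h' = fun y =>
      g' y * conj (h' y) + I * π * (b : ℂ) * (g y * conj (h' y))
        + (g' y + I * π * (b : ℂ) * g y)
          * conj (I * π * (s : ℂ) * h y + (π : ℂ) ^ 2 * (n : ℂ) * ∫ t in y..(1:ℝ), h t) := by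
    funext y
    simp only [dipoleIntegrandDet, map_add]
    ring
  rw [e]
  exact (i1.add (i2.const_mul _)).add i3

/-! ### Sesquilinearity of `M_R` -/

/-- **Linearity of `M_R` in the first profile** (one-sided kinked class). [cite: Zhang2022LandauSiegel, Prop 7.1 p.44, (8.11)–(8.12)] -/
theorem MformDet_add_smul_left (hu : KinkedProfile u u') (hf : KinkedProfile f f')
    (hh : KinkedProfile h h') (t : ℂ) :
    MformDet R (fun x => u x + t * f x) (fun x => u' x + t * f' x) h h'
      = MformDet R u u' h h' + t * MformDet R f f' h h' := by
  have key : ∀ j : Fin 3,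
      (∫ y in (0:ℝ)..1, dipoleIntegrandDet (R.b j) (R.s j) (R.n j)
          (fun x => u x + t * f x) (fun x => u' x + t * f' x) h h' y)
        = (∫ y in (0:ℝ)..1, dipoleIntegrandDet (R.b j) (R.s j) (R.n j) u u' h h' y)
          + t * ∫ y in (0:ℝ)..1, dipoleIntegrandDet (R.b j) (R.s j) (R.n j) f f' h h' y := by
    intro j
    rw [← intervalIntegral.integral_const_mul, ← intervalIntegral.integral_add
      (intervalIntegrable_dipoleIntegrandDet hu hh _ _ _)
      ((intervalIntegrable_dipoleIntegrandDet hf hh _ _ _).const_mul t)]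
    exact intervalIntegral.integral_congr fun y _ => by simp only [dipoleIntegrandDet]; ring
  simp only [MformDet, Fin.sum_univ_three, key]
  ring

/-- **Conjugate-linearity of `M_R` in the second profile** (one-sided kinked class).
[cite: Zhang2022LandauSiegel, Prop 7.1 p.44, (8.11)–(8.12)] -/
theorem MformDet_add_smul_right (hu : KinkedProfile u u') (hh : KinkedProfile h h')
    (hf : KinkedProfile f f') (t : ℂ) :
    MformDet R u u' (fun x => h x + t * f x) (fun x => h' x + t * f' x)
      = MformDet R u u' h h' + conj t * MformDet R u u' f f' := by
  have key : ∀ j : Fin 3,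
      (∫ y in (0:ℝ)..1, dipoleIntegrandDet (R.b j) (R.s j) (R.n j) u u'
          (fun x => h x + t * f x) (fun x => h' x + t * f' x) y)
        = (∫ y in (0:ℝ)..1, dipoleIntegrandDet (R.b j) (R.s j) (R.n j) u u' h h' y)
          + conj t * ∫ y in (0:ℝ)..1, dipoleIntegrandDet (R.b j) (R.s j) (R.n j) u u' f f' y := by
    intro j
    rw [← intervalIntegral.integral_const_mul, ← intervalIntegral.integral_add
      (intervalIntegrable_dipoleIntegrandDet hu hh _ _ _)
      ((intervalIntegrable_dipoleIntegrandDet hu hf _ _ _).const_mul (conj t))]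
    refine intervalIntegral.integral_congr fun y hy => ?_
    rw [uIcc_of_le zero_le_one] at hy
    have ih : IntervalIntegrable h volume y 1 :=
      (hh.cont.mono (Icc_subset_Icc_left hy.1)).intervalIntegrable_of_Icc hy.2
    have ifx : IntervalIntegrable f volume y 1 :=
      (hf.cont.mono (Icc_subset_Icc_left hy.1)).intervalIntegrable_of_Icc hy.2
    have htail : (∫ r in y..(1:ℝ), (h r + t * f r)) = (∫ r in y..(1:ℝ), h r) + t * ∫ r in y..(1:ℝ), f r := by
      rw [intervalIntegral.integral_add ih (ifx.const_mul t), intervalIntegral.integral_const_mul]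
    simp only [dipoleIntegrandDet, htail, map_add, map_mul]
    ring
  simp only [MformDet, Fin.sum_univ_three, key]
  ring

/-! ### Polarisation and Cauchy–Schwarz -/

/-- **Polarisation identity for `𝔅_R`:** `𝔅_R(u + tf) = 𝔅_R(u) + 2Re(conj t · P_R(u,f)) + ‖t‖²𝔅_R(f)` on one-sided
kinked profiles, for every recipe `R`. [cite: Zhang2022LandauSiegel, Prop 7.1 p.44, (8.11)–(8.12)] -/
theorem formDet_add_smul (hu : KinkedProfile u u') (hf : KinkedProfile f f') (t : ℂ) :
    FormDet R (fun x => u x + t * f x) (fun x => u' x + t * f' x)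
      = FormDet R u u' + 2 * (conj t * FormDetPolar R u u' f f').re + ‖t‖ ^ 2 * FormDet R f f' := by
  have huf := hu.add_smul hf t
  rw [formDet_eq_two_mul_re, formDet_eq_two_mul_re, formDet_eq_two_mul_re, FormDetPolar,
    MformDet_add_smul_left hu hf huf t, MformDet_add_smul_right hu hu hf t,
    MformDet_add_smul_right hf hu hf t]
  have hn : ‖t‖ ^ 2 = t.re * t.re + t.im * t.im := by
    rw [Complex.sq_norm, Complex.normSq_apply]
  rw [hn]
  simp only [Complex.add_re, Complex.mul_re, Complex.mul_im, Complex.conj_re, Complex.conj_im,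
    Complex.add_im]
  ring

/-- **PSD ⇒ exact Cauchy–Schwarz for the recipe form:** if `𝔅_R ≥ 0` on one-sided kinked profiles
(`FormDetPSD R`) then `‖P_R(u,f)‖² ≤ 𝔅_R(u)·𝔅_R(f)` there — for `R = zhangRecipe` this is
`norm_sq_mainTermFormPolar_le`. [cite: Zhang2022LandauSiegel, §2 (2.18)–(2.19), (2.32)–(2.33); Prop 7.1 p.44] -/
theorem norm_sq_formDetPolar_le_of_psd (hR : FormDetPSD R) (hu : KinkedProfile u u')
    (hf : KinkedProfile f f') (hu1 : u 1 = 0) (hf1 : f 1 = 0) :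
    ‖FormDetPolar R u u' f f'‖ ^ 2 ≤ FormDet R u u' * FormDet R f f' := by
  set P := FormDetPolar R u u' f f' with hP
  have hBu := hR u u' hu hu1
  have hBf := hR f f' hf hf1
  -- `𝔅_R(u − rP·f) = ‖P‖²𝔅_R(f)·r² − 2‖P‖²·r + 𝔅_R(u) ≥ 0` for every real `r`
  have hquad : ∀ r : ℝ, 0 ≤ (‖P‖ ^ 2 * FormDet R f f') * (r * r) + (-(2 * ‖P‖ ^ 2)) * r
      + FormDet R u u' := by
    intro r
    have h1' : (fun x => u x + (-(r : ℂ) * P) * f x) 1 = 0 := by simp [hu1, hf1]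
    have h := hR _ _ (hu.add_smul hf (-(r : ℂ) * P)) h1'
    rw [formDet_add_smul hu hf] at h
    have h1 : (conj (-(r : ℂ) * P) * P).re = -(r * ‖P‖ ^ 2) := by
      have e : conj (-(r : ℂ) * P) * P = -((r * ‖P‖ ^ 2 : ℝ) : ℂ) := by
        rw [map_mul, map_neg, Complex.conj_ofReal, mul_assoc, Complex.conj_mul']
        push_cast; ring
      rw [e, Complex.neg_re, Complex.ofReal_re]
    have h2 : ‖-(r : ℂ) * P‖ ^ 2 = r ^ 2 * ‖P‖ ^ 2 := by
      rw [norm_mul, norm_neg, Complex.norm_real, mul_pow, Real.norm_eq_abs, sq_abs]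
    rw [h1, h2] at h
    nlinarith [h]
  have hdisc := discrim_le_zero hquad
  rw [discrim] at hdisc
  by_cases hP0 : ‖P‖ ^ 2 = 0
  · rw [hP0]; exact mul_nonneg hBu hBf
  · have hpos : 0 < ‖P‖ ^ 2 := lt_of_le_of_ne (sq_nonneg _) (Ne.symm hP0)
    have h3 : ‖P‖ ^ 2 * ‖P‖ ^ 2 ≤ ‖P‖ ^ 2 * (FormDet R u u' * FormDet R f f') := by
      nlinarith [hdisc]
    exact le_of_mul_le_mul_left h3 hpos

/-- **«T-true» never holds for a PSD recipe:** `¬ (𝔅_R(𝔤)·𝔅_R(f) < ‖P_R(𝔤,f)‖²)` — the shape of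
`Repair.not_repairable_true_need` (`C₂₃₂·C₂₃₃ < ‖dSum‖²`), for every recipe with `FormDetPSD R` and one-sided
kinked `𝔤`, `f`. [cite: Zhang2022LandauSiegel, §2 (2.18)–(2.19), (2.32)–(2.34)] -/
theorem not_trueNeed_of_psd (hR : FormDetPSD R) (hg : KinkedProfile g g') (hf : KinkedProfile f f')
    (hg1 : g 1 = 0) (hf1 : f 1 = 0) :
    ¬ (FormDet R g g' * FormDet R f f' < ‖FormDetPolar R g g' f f'‖ ^ 2) :=
  not_lt.2 (norm_sq_formDetPolar_le_of_psd hR hg hf hg1 hf1)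

/-- **Thresholds of polar provenance never close the §2 final step, for any PSD recipe:** if
`𝔅_R(𝔤) ≤ q` ((2.32)-type), `𝔅_R(f) ≤ c_J` ((2.33)-type) and `d ≤ ‖P_R(𝔤,f)‖` (Prop 2.4-type), then
`¬ (√(q·c_J) < d)` — `not_closing_of_isH1` for a general detector recipe. [cite: Zhang2022LandauSiegel, §2 (2.18), Props 2.4–2.6 p.6, (2.32)–(2.33)] -/
theorem not_closing_of_psd (hR : FormDetPSD R) (hg : KinkedProfile g g') (hf : KinkedProfile f f')
    (hg1 : g 1 = 0) (hf1 : f 1 = 0) {q cJ d : ℝ} (hq : FormDet R g g' ≤ q) (hcJ : FormDet R f f' ≤ cJ)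
    (hd : d ≤ ‖FormDetPolar R g g' f f'‖) : ¬ (Real.sqrt (q * cJ) < d) := by
  refine not_lt.2 (hd.trans ?_)
  rw [← Real.sqrt_sq (norm_nonneg (FormDetPolar R g g' f f'))]
  refine Real.sqrt_le_sqrt ((norm_sq_formDetPolar_le_of_psd hR hg hf hg1 hf1).trans ?_)
  exact mul_le_mul hq hcJ (hR f f' hf hf1) ((hR g g' hg hg1).trans hq)

end Det

end Literature.NumberTheory.LFunctions.Zhang2022
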